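import Literature.Topology.PlanarFoliations.FacialCycle
import Literature.Topology.PlanarFoliations.Hugging
import HarnessLib

/-!
# An essential compact leaf of the planar foliation yields a vanishing cycle (generic case)

Topic: Topology / PlanarFoliations — the conclusion of the planar part of Novikov's argument
(Camacho–Lins Neto, Ch. VII §2, Prop. 3 and the minimal element): **if a compact leaf of the
planar foliation `F` has essential image in its leaf of `T`, then `T` has a vanishing cycle**,
under the genericity hypothesis `hgen` (every separatrix of the star data has the same puncture
at both ends — true when distinct punctures lie in distinct leaves of `T`).

Proof: `Hugging.exists_terminal_pattern'` gives a terminal essential pattern in the disc of the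
leaf — a terminal essential polygon (`FacialCycle`: the facial petal walk borders a band of
image-null leaves, `WalkVanishing`) or a terminal essential compact leaf (`ZoneOfTerminal`:
`VanishingBand`).

## References

* C. Camacho, A. Lins Neto, *Geometric Theory of Foliations*, Birkhäuser (1985), Ch. VII §2
  [CamachoLinsNeto1985].
-/

noncomputable section

open Set Filter Function Metric
open _root_.Topology
open Literature.Topology.FourManifolds Literature.Topology.FourManifolds.Foliation Literature.Topology.PlaneTopology

namespace Literature.Topology.PlanarFoliations

variable {X : Type*} [TopologicalSpace X] [T2Space X] [SecondCountableTopology X] [Nonempty X] {F : Foliation ℝ X} {ι : X → ℂ}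
variable {B : Type*} [NormedAddCommGroup B] [NormedSpace ℝ B] [LocallyConnectedSpace B] {M : Type*} [TopologicalSpace M]
  {T : Foliation B M} {g : ℂ → M}

namespace StarData

namespace CompactPattern

variable {D : StarData F ι T g} {hbi : IsBiOriented F} {hι : IsOpenEmbedding ι} {x₀ : X} {hC₀ : IsCompact (discLeaf F ι x₀)}

/-- The compact case with the position of the essential loop recorded (the proof of
`CompactPattern.nonempty_vanishingCycle_of_terminal`, keeping the conclusion of
`VanishingBand.exists_vanishingCycle`). [cite: CamachoLinsNeto1985, Ch. VII §2] -/
private theorem exists_vanishingCycle_of_terminal (K : D.CompactPattern x₀) (hbi : IsBiOriented F) (hι : IsOpenEmbedding ι)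
    (ho : F.IsTransverselyOriented) (hC₀ : IsCompact (discLeaf F ι x₀)) (hΩ : discLeaf F ι x₀ ⊆ D.Ω)
    (hterm : ∀ K' : D.CompactPattern x₀, discLeaf F ι K'.y ⊆ discLeaf F ι K.y → discLeaf F ι K'.y = discLeaf F ι K.y)
    (hpterm : ∀ Q : D.PolyPattern hbi hι x₀ hC₀, Q.Z.fill hι hC₀ ⊆ discLeaf F ι K.y → Q.Z.fill hι hC₀ = discLeaf F ι K.y) :
    ∃ C : T.VanishingCycle, ∀ θ, C.fam 0 θ ∈ range g := by
  have hιc := hι.continuous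
  -- the zone of the compact leaf
  obtain ⟨γ, hJ, hr, -, hfill⟩ := exists_isJordanLoop_leaf hbi hι K.compact
  have hγC : IsJordanLoop.fill γ ⊆ discLeaf F ι x₀ := hfill ▸ K.sub
  have hsat : ∀ x', ι x' ∈ range γ → ∀ x'' ∈ F.leaf x', ι x'' ∈ range γ := by
    intro x' hx' x'' hx''
    rw [hr] at hx' ⊢
    obtain ⟨w, hw, hwe⟩ := hx'
    have : x' ∈ F.leaf K.y := hι.injective hwe ▸ hw
    exact ⟨x'', by rw [← leaf_eq_of_mem this]; exact hx'', rfl⟩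
  have hcpt := K.imageNull_of_compact_inside hbi hι hterm hr hfill
  have hpoly := K.mem_range_of_essential hbi hι hC₀ hpterm hJ hfill
  have hlocAll : ∀ xk, ι xk ∈ range γ → ∃ e ∈ F.atlas, xk ∈ e.source ∧ ∃ ε > 0, ∀ x', ι x' ∈ range γ → x' ∈ e.source →
      |(e x').1 - (e xk).1| < ε → |(e x').2 - (e xk).2| < ε → (e x').2 = (e xk).2 := fun xk hk ↦ by
    obtain ⟨e, he, hxe⟩ := F.exists_mem_source xk
    exact ⟨e, he, hxe, K.trace_eq_plaque hbi hι hr xk hk he hxe⟩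
  -- the leaf loop of `K` has essential image
  obtain ⟨β, hc, hp, hinj, hsurj⟩ := exists_leafLoop_of_isCompact (x := K.y) hbi K.compact
  have hess : ¬ ((F.leafLoop (loopPath β hc hp) (continuous_toLeafSpace_loopPath β hc hp)).map
      D.foliated.continuous_leafMap).Homotopic (Path.refl _) := fun h ↦
    K.ess ⟨K.y, β, hc, hp, F.mem_leaf_self _, hinj, hsurj, h⟩
  -- a flow box at the base point, and the inner side
  obtain ⟨e₀, he₀, hx₀⟩ := F.exists_mem_source (loopBase β)
  have hbase : loopBase β ∈ F.leaf K.y := loopBase_mem_leaf β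
  have hbk : ι (loopBase β) ∈ range γ := by rw [hr]; exact ⟨_, hbase, rfl⟩
  obtain ⟨ε₁, hε₁, hloc⟩ := K.trace_eq_plaque hbi hι hr (loopBase β) hbk he₀ hx₀
  obtain ⟨s, hs, ε, hε, hin, -⟩ := exists_oneSided' hJ hsat hbk he₀ ⟨ε₁, hε₁, hloc⟩ hι hx₀
  -- the inner leaves through the vertical near the base are compact and image-null
  set sg : ℝ → X := fun t ↦ vert β e₀ (baseLevel β e₀ + s * t) with hsg
  have hsg0 : sg 0 = loopBase β := by
    simp only [hsg, mul_zero, add_zero]; exact vert_baseLevel hx₀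
  have hsgc : ContinuousWithinAt sg (Ioo 0 ε) 0 :=
    ((continuous_vert he₀).comp (continuous_const.add (continuous_const.mul continuous_id))).continuousWithinAt
  have hsgA : ∀ a ∈ Ioo 0 ε, ι (sg a) ∈ IsJordanLoop.inside γ := by
    intro a ha
    have habs : |s * a| = a := by rcases hs with rfl | rfl <;> simp [abs_of_pos ha.1]
    refine hin _ _ (by show |baseCoord β e₀ - (e₀ (loopBase β)).1| < ε; rw [baseCoord, sub_self, abs_zero]; exact hε)
      (by show |baseLevel β e₀ + s * a - (e₀ (loopBase β)).2| < ε; rw [baseLevel, add_sub_cancel_left, habs]; exact ha.2)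
      (by show 0 < s * (baseLevel β e₀ + s * a - (e₀ (loopBase β)).2)
          rw [baseLevel, add_sub_cancel_left, ← mul_assoc, show s * s = 1 by rcases hs with rfl | rfl <;> norm_num, one_mul]
          exact ha.1)
  have hev := D.eventually_compact_imageNull hbi hι ho hC₀ hΩ hJ hγC hsat hcpt hpoly hlocAll hsgc (by rw [hsg0]; exact hbk) hsgA
  obtain ⟨δ₁, hδ₁, hδ⟩ : ∃ δ₁ > 0, ∀ a ∈ Ioo 0 ε, dist a 0 < δ₁ → IsCompact (F.leaf (sg a)) ∧ ImageNull D.foliated (sg a) := by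
    rw [eventually_nhdsWithin_iff, Metric.eventually_nhds_iff] at hev
    obtain ⟨δ₁, hδ₁, h⟩ := hev
    exact ⟨δ₁, hδ₁, fun a ha hd ↦ h hd ha⟩
  set δ := min δ₁ ε with hδdef
  have hband : ∀ t ∈ Ioo 0 δ, ImageNull D.foliated (vert β e₀ (baseLevel β e₀ + s * t)) := by
    intro t ht
    have hd : dist t 0 < δ₁ := by
      rw [dist_zero_right, Real.norm_eq_abs, abs_of_pos ht.1]; exact ht.2.trans_le (min_le_left _ _)
    exact (hδ t ⟨ht.1, ht.2.trans_le (min_le_right _ _)⟩ hd).2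
  obtain ⟨C, hC⟩ := exists_vanishingCycle hbi hι ho D.foliated hc hp he₀ hx₀ hess hs (lt_min hδ₁ hε) hband
  exact ⟨C, fun θ ↦ ⟨_, (hC θ).symm⟩⟩

end CompactPattern

/-- **An essential compact leaf yields a vanishing cycle** (generic case): for star data `D`
of a bi-oriented, transversely oriented planar foliation over the foliated map `g ∘ ι` to `T`,
a compact leaf whose disc lies in the domain `Ω`, inside which every separatrix has one
puncture at both ends (`hgen`, the genericity hypothesis), and whose image loop is not
null-homotopic in its leaf of `T`, forces a vanishing cycle of `T`, whose essential loop lies in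
the image of the disc map `g`. [cite: CamachoLinsNeto1985, Ch. VII §2, Prop. 3] -/
theorem exists_vanishingCycle_of_essential_compact_leaf (D : StarData F ι T g) (hbi : IsBiOriented F) (hι : IsOpenEmbedding ι)
    (ho : F.IsTransverselyOriented) {x₀ : X}
    (hgen : ∀ (y : X) [NoncompactSpace (F.Leaf y)], (∀ q : F.Leaf y, ι (Leaf.pt q) ∈ discLeaf F ι x₀) →
      ∀ v ∈ D.P, ∀ w ∈ D.P, omegaSet hbi ι y = {v} → alphaSet hbi ι y = {w} → v = w)
    (hK₀ : IsCompact (F.leaf x₀)) (hΩ : discLeaf F ι x₀ ⊆ D.Ω) (hess₀ : ¬ ImageNull D.foliated x₀) :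
    ∃ C : T.VanishingCycle, ∀ θ, C.fam 0 θ ∈ range g := by
  have hC₀ : IsCompact (discLeaf F ι x₀) := isCompact_discLeaf hbi hι hK₀
  rcases D.exists_terminal_pattern' hbi hι ho hC₀ hΩ hK₀ hess₀ with ⟨P, hPt, hPc⟩ | ⟨K, hKp, hKc⟩
  · exact PolyPattern.exists_vanishingCycle_of_terminal ho hK₀ hΩ hgen P hPt hPc
  · exact K.exists_vanishingCycle_of_terminal hbi hι ho hC₀ hΩ hKc hKp

end StarData

end Literature.Topology.PlanarFoliations
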